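import Literature.AlgebraicGeometry.HodgeTheory.UniversalHypersurfaceDiscriminantBranches
import Literature.AlgebraicGeometry.HodgeTheory.OrdinaryDoublePointSliceCriterion
import HarnessLib

/-!
# Members of the universal family on ONE local branch of the discriminant are one-nodal
# (node charts: persistence of the ordinary double point, uniqueness of the singular point)

Family `hodge`, layer `Literature/AlgebraicGeometry/HodgeTheory`; sequel of
`UniversalHypersurfaceDiscriminantNodeChart` (`DiscriminantBranches.NodeChart`: the implicit-function chart
`a ↦ x(a)` of the node and the branch function `φ(a) = F_a(x(a))`, Voisin II §2.1.1 Lemma 2.7 / Cor. 2.8) and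
`UniversalHypersurfaceDiscriminantBranches`. Theorems only (no definition of mathematical content no named fact). Written by the prover seat
`hodge-nonav-20241-p1` (g18, cell `hodge-nonav`) as brick (P1a) of programme «PL2-MERIDIANS» (registry binder
hPL₂exch = `picardLefschetz_exchangedPair` of crux K1-B, stmt-HodgeConjecture-19716): the one-node meridians
around which the pencil circle of a two-nodal form decomposes are pencil circles around members lying on
exactly ONE branch, and those members must be shown ONE-NODAL for hPL₁ = `picardLefschetz_oneNode` to apply.

* §1 `NodeChart.eval_node_pderiv_of_branchFun_eq_zero` — `φ(a) = 0 ⟹ ∇F_a(x(a)) = 0` (Euler at the node,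
  `x(a)_{j₀} = p_{j₀} ≠ 0`); `NodeChart.node_eq_of_singular` — a singular point of `F_a` inside `Ω`, normalised
  by `x_{j₀} = p_{j₀}`, IS `x(a)` (uniqueness half of the implicit function theorem).
* §2 `NodeChart.eventually_isOrdinaryDoublePointOf_node` — for `a` near `a₁ = coeffsOf f₁` with `φ(a) = 0`,
  `x(a)` is an ORDINARY double point of `F_a`: the principal block of `Hess(F_a)(x(a))` off the chart index `j₀`
  has non-zero determinant at `a₁` (`det_prinBlock_hessianAt_ne_zero`: kernel `ℂp`, `p_{j₀} ≠ 0`, symmetry and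
  Euler) and depends continuously on `a`; a non-degenerate block makes the Hessian injective on the slice
  `{z_{j₀} = 0}` (`slice_injective_of_det_prinBlock_ne_zero`), whence `isOrdinaryDoublePointOf_of_slice_injective`.
* §3 `eventually_isNodalFormWithNodes_of_branch_only` — for a nodal form `f₁` with nodes `[p_i]` and node
  charts `C i`: for `a` near `a₁`, if `φ_i(a) = 0` and `φ_{i'}(a) ≠ 0` for `i' ≠ i` then `F_a` is ONE-NODAL with
  node `x_i(a)` (`IsNodalFormWithNodes (formOfCoeffs a) ![(C i).node a]`): every singular point scales into the
  chart of some node (`eventually_forall_singular_near_nodes`, compactness of the sphere) and is then the node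
  of a vanishing branch function.

Honest scope: local structure of the discriminant only; nothing here is about monodromy or HC.

## References

* [VoisinHodgeII2003] C. Voisin, Hodge Theory and Complex Algebraic Geometry II, CUP 2003, §2.1.1 Lemma 2.7,
  Cor. 2.8, pp. 69–70; §2.3.1 (ordinary double points, Lefschetz pencils).
* [GriffithsHarris1978] P. Griffiths, J. Harris, Principles of Algebraic Geometry, Ch. 0 §1 (holomorphic
  implicit function theorem).
-/

noncomputable section

open MvPolynomial
open _root_.Topology _root_.Filter Set
open Literature.AlgebraicGeometry.Motives Literature.AlgebraicGeometry.Motives.UniversalHypersurface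

namespace Literature.AlgebraicGeometry.HodgeTheory

namespace DiscriminantBranches

variable {n d : ℕ}

/-! ### §1 Node charts: the gradient at the node, uniqueness of the singular point -/

namespace NodeChart

variable {f₁ : MvPolynomial (Fin (n + 2)) ℂ} {p : Fin (n + 2) → ℂ} {j₀ : Fin (n + 2)} (C : NodeChart n d f₁ p j₀)

/-- The node `x(a)` is a non-zero vector (`x(a)_{j₀} = p_{j₀} ≠ 0`). [cite: VoisinHodgeII2003, §2.1.1 Lemma 2.7] -/
theorem node_ne_zero (hj₀ : p j₀ ≠ 0) {a : DegIndex n d → ℂ} (ha : a ∈ C.T) : C.node a ≠ 0 := fun h =>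
  hj₀ (by rw [← C.node_apply_j₀ a ha, h, Pi.zero_apply])

/-- **`φ(a) = 0` ⟹ all partials of `F_a` vanish at the node `x(a)`** (the partials `j ≠ j₀` vanish by
construction of the chart, `F_a(x(a)) = φ(a) = 0`, and Euler's relation kills `∂_{j₀}` since
`x(a)_{j₀} = p_{j₀} ≠ 0`). [cite: VoisinHodgeII2003, §2.1.1 Lemma 2.7] [cite: Hartshorne1977, I Ex. 5.8] -/
theorem eval_node_pderiv_of_branchFun_eq_zero (hj₀ : p j₀ ≠ 0) {a : DegIndex n d → ℂ} (ha : a ∈ C.T)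
    (h0 : C.branchFun a = 0) (j : Fin (n + 2)) : eval (C.node a) (pderiv j (formOfCoeffs a)) = 0 := by
  rw [C.branchFun_eq a ha] at h0
  have hxj₀ : C.node a j₀ = p j₀ := C.node_apply_j₀ a ha
  by_cases hj : j = j₀
  · subst hj
    have hE := congrArg (eval (C.node a)) (isHomogeneous_formOfCoeffs a).sum_X_mul_pderiv
    simp only [map_sum, map_mul, eval_X, map_nsmul, h0, smul_zero] at hE
    rw [← Finset.sum_erase_add _ _ (Finset.mem_univ j), Finset.sum_eq_zero (fun i hi => by
      rw [Finset.mem_erase] at hi; rw [C.eval_node_pderiv a ha hi.1, mul_zero]), zero_add] at hE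
    exact (mul_eq_zero.1 hE).resolve_left (hxj₀ ▸ hj₀)
  · exact C.eval_node_pderiv a ha hj

/-- `φ(a) = 0` ⟹ `F_a(x(a)) = 0`. [cite: VoisinHodgeII2003, §2.1.1 Cor. 2.8] -/
theorem eval_node_eq_zero_of_branchFun_eq_zero {a : DegIndex n d → ℂ} (ha : a ∈ C.T) (h0 : C.branchFun a = 0) :
    eval (C.node a) (formOfCoeffs a) = 0 := by
  rw [← C.branchFun_eq a ha]; exact h0

/-- **Uniqueness: a critical point of `F_a` inside `Ω`, normalised by `x_{j₀} = p_{j₀}`, is the node `x(a)`.**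
[cite: VoisinHodgeII2003, §2.1.1 Lemma 2.7] -/
theorem node_eq_of_singular {a : DegIndex n d → ℂ} {x : Fin (n + 2) → ℂ} (hΩ : Sum.elim x a ∈ C.Ω)
    (hxj₀ : x j₀ = p j₀) (hpart : ∀ j, eval x (pderiv j (formOfCoeffs a)) = 0) : a ∈ C.T ∧ C.node a = x := by
  obtain ⟨hT, hψ⟩ := C.unique (Sum.elim x a) hΩ (by simpa using hxj₀) (fun j _ => by simpa using hpart j)
  simp only [prA_apply, Sum.elim_inr] at hT hψ
  rw [show (fun m => a m) = a from rfl] at hT hψ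
  refine ⟨hT, ?_⟩
  funext j
  have := congr_fun hψ (Sum.inl j)
  simpa [NodeChart.node, prX_apply] using this

end NodeChart

/-! ### §2 Persistence of the ordinary double point along the node chart -/

section Persistence

/-- Splitting `Σ_j M_{ij} z_j` off the index `j₀` when `z_{j₀} = 0`. [folklore] -/
private theorem sum_mul_eq_sum_subtype (M : Matrix (Fin (n + 2)) (Fin (n + 2)) ℂ) (j₀ i : Fin (n + 2))
    {z : Fin (n + 2) → ℂ} (hzj₀ : z j₀ = 0) :
    ∑ j, M i j * z j = ∑ j : {j : Fin (n + 2) // j ≠ j₀}, M i j.1 * z j.1 := by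
  rw [← Fintype.sum_subtype_add_sum_subtype (fun j => j ≠ j₀) (fun j => M i j * z j)]
  have h0 : ∑ j : {j : Fin (n + 2) // ¬ j ≠ j₀}, M i j.1 * z j.1 = 0 := Finset.sum_eq_zero fun j _ => by
    have hj : j.1 = j₀ := not_ne_iff.mp j.2
    rw [hj, hzj₀, mul_zero]
  rw [h0, add_zero]

/-- **A non-degenerate principal block off `j₀` makes the matrix injective on the slice `{z_{j₀} = 0}`.**
[cite: VoisinHodgeII2003, §2.1.1 Lemma 2.7] -/
theorem slice_injective_of_det_prinBlock_ne_zero (M : Matrix (Fin (n + 2)) (Fin (n + 2)) ℂ) (j₀ : Fin (n + 2))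
    (hdet : (M.submatrix (fun i : {i : Fin (n + 2) // i ≠ j₀} => i.1) (fun i : {i : Fin (n + 2) // i ≠ j₀} => i.1)).det ≠ 0) (z : Fin (n + 2) → ℂ) (hzj₀ : z j₀ = 0) (hz : M.mulVec z = 0) : z = 0 := by
  classical
  set z' : {i : Fin (n + 2) // i ≠ j₀} → ℂ := fun i => z i.1 with hz'
  have hz'0 : (M.submatrix (fun i : {i : Fin (n + 2) // i ≠ j₀} => i.1) (fun i : {i : Fin (n + 2) // i ≠ j₀} => i.1)).mulVec z' = 0 := by
    funext i
    have hi := congr_fun hz i.1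
    simp only [Matrix.mulVec, dotProduct, Pi.zero_apply] at hi ⊢
    rw [sum_mul_eq_sum_subtype M j₀ i.1 hzj₀] at hi
    exact hi
  have hz'z : z' = 0 := Matrix.eq_zero_of_mulVec_eq_zero hdet hz'0
  funext j
  by_cases hj : j = j₀
  · rw [hj, hzj₀, Pi.zero_apply]
  · have := congr_fun hz'z ⟨j, hj⟩
    simpa [hz'] using this

variable {f₁ : MvPolynomial (Fin (n + 2)) ℂ} {p : Fin (n + 2) → ℂ}

/-- The Hessian matrix is symmetric. [cite: VoisinHodgeII2003, §2.1.1 Cor. 2.8] -/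
theorem hessianAt_transpose (f₁ : MvPolynomial (Fin (n + 2)) ℂ) (p : Fin (n + 2) → ℂ) :
    (hessianAt f₁ p).transpose = hessianAt f₁ p :=
  Matrix.ext fun i j => hessianAt_comm f₁ p j i

/-- **At an ordinary double point `p` with `p_{j₀} ≠ 0`, the principal block of the Hessian off `j₀` is
non-degenerate.** (If `B z' = 0`, extend `z'` by `z_{j₀} = 0`; the rows `≠ j₀` of `Hess·z` vanish, and the row
`j₀` too since `Σ_l p_l (Hess·z)_l = Σ_i z_i (Hess·p)_i = 0` by symmetry and Euler; so `z ∈ ker Hess = ℂp`,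
and `z_{j₀} = 0 ≠ p_{j₀}` forces `z = 0`.) [cite: VoisinHodgeII2003, §2.1.1 Lemma 2.7 and Cor. 2.8] -/
theorem det_prinBlock_hessianAt_ne_zero (hf₁ : f₁.IsHomogeneous d) (h : IsOrdinaryDoublePointOf f₁ p)
    {j₀ : Fin (n + 2)} (hj₀ : p j₀ ≠ 0) : ((hessianAt f₁ p).submatrix (fun i : {i : Fin (n + 2) // i ≠ j₀} => i.1) (fun i : {i : Fin (n + 2) // i ≠ j₀} => i.1)).det ≠ 0 := by
  classical
  intro hdet
  obtain ⟨z', hz'0, hz'mul⟩ := Matrix.exists_mulVec_eq_zero_iff.2 hdet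
  -- extend by zero
  let z : Fin (n + 2) → ℂ := fun j => if hj : j ≠ j₀ then z' ⟨j, hj⟩ else 0
  have hzj₀ : z j₀ = 0 := by simp [z]
  have hz_of : ∀ i : {i : Fin (n + 2) // i ≠ j₀}, z i.1 = z' i := fun i => by simp [z, i.2]
  -- rows `≠ j₀`
  have hrows : ∀ i, i ≠ j₀ → (hessianAt f₁ p).mulVec z i = 0 := by
    intro i hi
    have hi' := congr_fun hz'mul ⟨i, hi⟩
    simp only [Matrix.mulVec, dotProduct, Pi.zero_apply] at hi' ⊢
    rw [sum_mul_eq_sum_subtype _ j₀ i hzj₀]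
    rw [← hi']
    exact Finset.sum_congr rfl fun j _ => by rw [hz_of j]; rfl
  -- row `j₀`, by symmetry and Euler
  have hrow₀ : (hessianAt f₁ p).mulVec z j₀ = 0 := by
    have hHp : (hessianAt f₁ p).mulVec p = 0 := hessianAt_mulVec_self hf₁ h.eval_pderiv
    have h1 : p ⬝ᵥ (hessianAt f₁ p).mulVec z = 0 := by
      rw [Matrix.dotProduct_mulVec, ← Matrix.mulVec_transpose, hessianAt_transpose, hHp, zero_dotProduct]
    rw [dotProduct, Finset.sum_eq_single j₀ (fun l _ hl => by rw [hrows l hl, mul_zero])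
      (fun hj => (hj (Finset.mem_univ _)).elim)] at h1
    exact (mul_eq_zero.1 h1).resolve_left hj₀
  have hz0 : (hessianAt f₁ p).mulVec z = 0 := by
    funext i
    by_cases hi : i = j₀
    · rw [hi]; exact hrow₀
    · exact hrows i hi
  -- so `z ∈ ker Hess = ℂ p`
  have hmem : z ∈ LinearMap.ker (hessianAt f₁ p).mulVecLin := by
    rw [LinearMap.mem_ker, Matrix.mulVecLin_apply]; exact hz0
  rw [ker_hessianAt_eq_span hf₁ h, Submodule.mem_span_singleton] at hmem
  obtain ⟨t, ht⟩ := hmem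
  have ht0 : t = 0 := by
    have := congr_fun ht j₀
    rw [Pi.smul_apply, smul_eq_mul, hzj₀] at this
    exact (mul_eq_zero.1 this).resolve_right hj₀
  apply hz'0
  funext i
  rw [← hz_of i, ← ht, ht0, zero_smul]
  rfl

/-- **Persistence of the ordinary double point along the node chart.** For `a` near `a₁ = coeffsOf f₁` with
`φ(a) = 0`, the node `x(a)` is an ORDINARY double point of `F_a` (the principal block of `Hess(F_a)(x(a))` off
`j₀` is a continuous function of `a` on the chart, non-degenerate at `a₁`). [cite: VoisinHodgeII2003, §2.1.1 Lemma 2.7] -/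
theorem NodeChart.eventually_isOrdinaryDoublePointOf_node {j₀ : Fin (n + 2)} (C : NodeChart n d f₁ p j₀)
    (hf₁ : f₁.IsHomogeneous d) (h : IsOrdinaryDoublePointOf f₁ p) (hj₀ : p j₀ ≠ 0) :
    ∀ᶠ a in 𝓝 (coeffsOf n d f₁), C.branchFun a = 0 → IsOrdinaryDoublePointOf (formOfCoeffs a) (C.node a) := by
  classical
  -- the block as a function of `a`, continuous on the chart domain
  set M : (DegIndex n d → ℂ) → Matrix {i : Fin (n + 2) // i ≠ j₀} {i : Fin (n + 2) // i ≠ j₀} ℂ := fun a =>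
    (hessianAt (formOfCoeffs a) (C.node a)).submatrix (fun i : {i : Fin (n + 2) // i ≠ j₀} => i.1) (fun i : {i : Fin (n + 2) // i ≠ j₀} => i.1) with hM
  have hentry : ∀ a ∈ C.T, ∀ (i j : {i : Fin (n + 2) // i ≠ j₀}), M a i j =
      eval (C.ψ a) (pderiv (Sum.inl i.1) (pderiv (Sum.inl j.1) (jointForm n d))) := by
    intro a ha i j
    rw [C.ψ_eq a ha, eval_pderiv_inl_pderiv_inl_jointForm]
    rfl
  have hMc : ContinuousAt M (coeffsOf n d f₁) := by
    have hψc : ContinuousAt C.ψ (coeffsOf n d f₁) :=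
      (C.analyticOnNhd _ C.mem_T).continuousAt
    refine continuousAt_pi.2 fun i => continuousAt_pi.2 fun j => ?_
    have he : ContinuousAt (fun a => eval (C.ψ a) (pderiv (Sum.inl i.1) (pderiv (Sum.inl j.1) (jointForm n d))))
        (coeffsOf n d f₁) := (continuous_eval _).continuousAt.comp hψc
    refine he.congr ?_
    filter_upwards [C.isOpen_T.mem_nhds C.mem_T] with a ha
    exact (hentry a ha i j).symm
  have hdet : ContinuousAt (fun a => (M a).det) (coeffsOf n d f₁) := (continuous_id.matrix_det).continuousAt.comp hMc
  have h0 : (M (coeffsOf n d f₁)).det ≠ 0 := by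
    have := det_prinBlock_hessianAt_ne_zero hf₁ h hj₀
    rw [hM]; dsimp only
    rwa [C.node_base, formOfCoeffs_coeffsOf n d hf₁]
  filter_upwards [hdet.eventually_ne h0, C.isOpen_T.mem_nhds C.mem_T] with a ha haT h0a
  exact isOrdinaryDoublePointOf_of_slice_injective (isHomogeneous_formOfCoeffs a)
    (by rw [C.node_apply_j₀ a haT]; exact hj₀) (C.eval_node_pderiv_of_branchFun_eq_zero hj₀ haT h0a)
    (slice_injective_of_det_prinBlock_ne_zero _ j₀ ha)

end Persistence

/-! ### §3 Members on exactly one branch are one-nodal -/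

section BranchOnly

variable {k : ℕ} {f₁ : MvPolynomial (Fin (n + 2)) ℂ} {p : Fin k → Fin (n + 2) → ℂ} {j₀ : Fin k → Fin (n + 2)}

/-- **Euler**: a form of degree `d ≥ 1` vanishes wherever all its partials vanish. [cite: Hartshorne1977, I Ex. 5.8] -/
theorem eval_eq_zero_of_forall_eval_pderiv_eq_zero {F : MvPolynomial (Fin (n + 2)) ℂ} (hF : F.IsHomogeneous d)
    (hd : 1 ≤ d) {z : Fin (n + 2) → ℂ} (hz : ∀ j, eval z (pderiv j F) = 0) : eval z F = 0 := by
  have hE := hF.sum_X_mul_pderiv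
  have h1 : eval z (∑ i, X i * pderiv i F) = 0 := by
    rw [map_sum]
    exact Finset.sum_eq_zero fun i _ ↦ by rw [map_mul, hz i, mul_zero]
  rw [hE, map_nsmul, nsmul_eq_mul] at h1
  exact (mul_eq_zero.1 h1).resolve_left (by exact_mod_cast (show d ≠ 0 by omega))

/-- **Members of the universal family on exactly ONE local branch of the discriminant are one-nodal.** Let the
singular points of the degree-`d` form `f₁` be exactly the nodes `[p_i]`, with node charts `C i` (chart
coordinates `j₀ i`, `(p_i)_{j₀ i} ≠ 0`). Then for every coefficient vector `a` close to `a₁ = coeffsOf f₁`: if the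
branch function of the node `i` vanishes at `a` and those of the other nodes do not, `F_a` is a nodal form whose
ONLY singular point is the node `x_i(a)` (`IsNodalFormWithNodes (formOfCoeffs a) ![(C i).node a]`).
[cite: VoisinHodgeII2003, §2.1.1 Lemma 2.7 and pp. 69–70, §2.3.1] -/
theorem eventually_isNodalFormWithNodes_of_branch_only (hf₁ : f₁.IsHomogeneous d)
    (hnod : IsNodalFormWithNodes f₁ p) (hj₀ : ∀ i, p i (j₀ i) ≠ 0) (C : ∀ i, NodeChart n d f₁ (p i) (j₀ i)) :
    ∀ᶠ a in 𝓝 (coeffsOf n d f₁), ∀ i, (C i).branchFun a = 0 → (∀ i', i' ≠ i → (C i').branchFun a ≠ 0) →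
      IsNodalFormWithNodes (formOfCoeffs a) ![(C i).node a] := by
  classical
  set a₁ := coeffsOf n d f₁ with ha₁
  -- Step 1: product neighbourhoods `U i × V i` of `(a₁, p i)` normalising into `Ω i`
  have hUV : ∀ i, ∃ (U : Set (DegIndex n d → ℂ)) (V : Set (Fin (n + 2) → ℂ)), IsOpen U ∧ a₁ ∈ U ∧
      IsOpen V ∧ p i ∈ V ∧ ∀ a ∈ U, ∀ x ∈ V, x (j₀ i) ≠ 0 ∧
        (Sum.elim ((p i (j₀ i) / x (j₀ i)) • x) a : JVar n d → ℂ) ∈ (C i).Ω := by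
    intro i
    let g : (DegIndex n d → ℂ) × (Fin (n + 2) → ℂ) → (JVar n d → ℂ) := fun q =>
      Sum.elim ((p i (j₀ i) / q.2 (j₀ i)) • q.2) q.1
    have hg : ContinuousAt g (a₁, p i) := by
      refine continuousAt_pi.2 fun v => ?_
      rcases v with j | m
      · simp only [g, Sum.elim_inl, Pi.smul_apply, smul_eq_mul]
        refine ContinuousAt.mul (ContinuousAt.div continuousAt_const ?_ (hj₀ i)) ?_
        · exact ((continuous_apply (j₀ i)).comp continuous_snd).continuousAt
        · exact ((continuous_apply j).comp continuous_snd).continuousAt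
      · exact ((continuous_apply m).comp continuous_fst).continuousAt
    have hg0 : g (a₁, p i) = Sum.elim (p i) a₁ := by
      simp only [g, div_self (hj₀ i), one_smul]
    have h1 : g ⁻¹' (C i).Ω ∈ 𝓝 (a₁, p i) :=
      hg.preimage_mem_nhds (by rw [hg0]; exact (C i).isOpen_Ω.mem_nhds (C i).mem_Ω)
    have h2 : {q : (DegIndex n d → ℂ) × (Fin (n + 2) → ℂ) | q.2 (j₀ i) ≠ 0} ∈ 𝓝 (a₁, p i) :=
      (isOpen_ne_fun ((continuous_apply (j₀ i)).comp continuous_snd) continuous_const).mem_nhds (hj₀ i)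
    obtain ⟨U, hU, V, hV, hsub⟩ := mem_nhds_prod_iff.1 (Filter.inter_mem h2 h1)
    obtain ⟨U', hU'U, hU'o, haU'⟩ := mem_nhds_iff.1 hU
    obtain ⟨V', hV'V, hV'o, hpV'⟩ := mem_nhds_iff.1 hV
    refine ⟨U', V', hU'o, haU', hV'o, hpV', fun a ha x hx => ?_⟩
    have := hsub (Set.mk_mem_prod (hU'U ha) (hV'V hx))
    exact ⟨this.1, this.2⟩
  choose U V hUo haU hVo hpV hUV using hUV
  -- Step 2: singular points of nearby forms land in some `V i` after scaling; nodes persist as ODPs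
  have hnear := eventually_forall_singular_near_nodes hf₁ hnod V hVo hpV
  have hodp := eventually_all.2 fun i => (C i).eventually_isOrdinaryDoublePointOf_node hf₁ (hnod.1 i) (hj₀ i)
  have hU' : ∀ᶠ a in 𝓝 a₁, ∀ i, a ∈ U i := eventually_all.2 fun i => (hUo i).mem_nhds (haU i)
  rcases Nat.eq_zero_or_pos k with hk | hk
  · subst hk; exact Filter.Eventually.of_forall fun a i => i.elim0
  have hd : 1 ≤ d := by
    have := two_le_of_isOrdinaryDoublePointOf hf₁ (hnod.1 ⟨0, hk⟩); omega
  filter_upwards [hnear, hodp, hU'] with a hnear_a hodp_a hU_a i hi hother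
  refine ⟨fun i₀ => ?_, fun i₀ i₀' _ => Subsingleton.elim _ _, fun z hz0 hpart => ?_⟩
  · -- the node is an ordinary double point
    fin_cases i₀
    exact hodp_a i hi
  · -- every singular point is the node `x_i(a)`
    obtain ⟨i', t, htz⟩ := hnear_a z hz0 hpart
    obtain ⟨hne, hΩ⟩ := hUV i' a (hU_a i') (t • z) htz
    set s : ℂ := p i' (j₀ i') / (t • z) (j₀ i') * t with hs
    have hx : (p i' (j₀ i') / (t • z) (j₀ i')) • (t • z) = s • z := by rw [smul_smul]
    rw [hx] at hΩ
    have hsj : (s • z) (j₀ i') = p i' (j₀ i') := by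
      have : (s • z) (j₀ i') = p i' (j₀ i') / (t • z) (j₀ i') * (t • z) (j₀ i') := by
        simp only [hs, Pi.smul_apply, smul_eq_mul]; ring
      rw [this, div_mul_cancel₀ _ hne]
    have hpart' : ∀ j, eval (s • z) (pderiv j (formOfCoeffs a)) = 0 := fun j => by
      rw [eval_smul_of_isHomogeneous (isHomogeneous_formOfCoeffs a).pderiv, hpart j, mul_zero]
    have hF' : eval (s • z) (formOfCoeffs a) = 0 := by
      rw [eval_smul_of_isHomogeneous (isHomogeneous_formOfCoeffs a),
        eval_eq_zero_of_forall_eval_pderiv_eq_zero (isHomogeneous_formOfCoeffs a) hd hpart, mul_zero]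
    -- so the branch function `i'` vanishes: `i' = i`, and `x_i(a) = s • z`
    have hφ := ((C i').branchFun_eq_zero_of_singular hΩ hsj hpart' hF').2
    have hii' : i' = i := by
      by_contra h
      exact hother i' h hφ
    subst hii'
    obtain ⟨-, hnode⟩ := (C i').node_eq_of_singular hΩ hsj hpart'
    have hs0 : s ≠ 0 := by
      intro h0
      rw [h0, zero_smul, Pi.zero_apply] at hsj
      exact hj₀ i' hsj.symm
    refine ⟨0, s⁻¹, ?_⟩
    simp only [Matrix.cons_val_zero]
    rw [hnode, smul_smul, inv_mul_cancel₀ hs0, one_smul]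

end BranchOnly

end DiscriminantBranches

end Literature.AlgebraicGeometry.HodgeTheory

end
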